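import Summits.NavierStokesRegularity.NavierStokesRegularity.Theorems.ExtremiserTransienceNearExtremalTransienceExtremiserLiouvilleConstantSpeedDossier
import Summits.NavierStokesRegularity.NavierStokesRegularity.Theorems.ExtremiserTransienceNearExtremalTransienceExtremiserLiouvilleConstantSpeedTangentialTest
import Summits.NavierStokesRegularity.NavierStokesRegularity.Theorems.ExtremiserTransienceNearExtremalTransienceExtremiserLiouvilleConstantSpeedDensityIntegrable
import Summits.NavierStokesRegularity.NavierStokesRegularity.Theorems.ExtremiserTransienceNearExtremalTransienceExtremiserLiouvilleConstantSpeedLinearMoments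
import HarnessLib

/-!
# Crux `ExtremiserTransience.NearExtremalTransience` (stmt-NavierStokesRegularity-21883), line `extremiser_liouville`,
# stub K1b — DOSSIER v2: K1b ⟸ «no constant-speed analytic extremiser WITH ITS MULTIPLIER MEASURE and all proven laws»

`--supports stmt-NavierStokesRegularity-21883` (helper).  Author: prover seat `ns-el-k1b` (g3).

`stub_noAnalyticExtremal_of_noMultiplierDossier`: the registered stub K1b (conclusion VERBATIM) follows from the non-existence of
a quadruple `(w, c, M, μ)` — the residue object of g2's dossier (`…ConstantSpeedDossier`: analytic, smooth, divergence free,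
`‖Dw‖` bounded, `D¹w, D²w ∈ L²`, `‖w‖ ≡ M > 0`, far field `c` with `‖c‖ = M`, `w − c → 0`, `w − c ∈ L⁶`,
`⟪w − c, c⟫ = −‖w − c‖²/2`, reversal, slow decay, `0 < M√Z√W`, exact extremality, KKT for all solenoidal test fields) TOGETHER
WITH its KKT multiplier measure `μ` and every law proved by this seat: `μ` finite, `S²/(2M²) ≤ μ(ℝ³) ≤ κ⋆²ZW`,
`ℓ = ⟪w,·⟫μ` on solenoidal test fields, `∫‖w−c‖²dμ = 2S²`, `∫⟪w,c⟫dμ ≤ 0`, the helicity law `⟪w,curl w⟫μ = ⟪G,w⟫dx` with the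
explicit E–L density `G`, the pointwise sign law, the strong E–L system `G = curl(qw)` on the twist set, `q ∈ L¹` with
`∫_U q ≤ κ⋆²ZW`, the vanishing symmetric virial moments, the angular moment `∫χ_R⟪G, c×x⟫ → 2∫⟪w,c⟫dμ`, and the second-order
condition along every exactly tangential test field `curl(Ψ₀ − (⟪w,curl Ψ₀⟫/⟪w,curl w⟫)w)`.
This is the complete first/second-order description available today; a refuter exhibiting such a quadruple refutes K1b's
premise-free provability by this line, a planner killing it proves K1b.

WHAT THIS IS NOT: K1b is NOT proved; nothing here proves NS regularity. [folklore]
-/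

noncomputable section

open Set Filter Topology MeasureTheory Metric Function
open scoped ENNReal NNReal Topology InnerProductSpace RealInnerProductSpace ContDiff Laplacian
open Literature.Analysis.FluidPDE Literature.Analysis

namespace Summit.NavierStokesRegularity.NavierStokesRegularity.Theorems

-- the problem directory repeats the summit name (`NavierStokesRegularity/NavierStokesRegularity`)
set_option linter.dupNamespace false

namespace ExtremiserLiouville

open DepletionLadder.KStar DepletionLadder.KStar.HalfSpace

/-- **K1b ⟸ no multiplier-dossier object** (g2's dossier + the multiplier measure and all its laws). [folklore] -/
theorem stub_noAnalyticExtremal_of_noMultiplierDossier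
    (hres : ¬ ∃ (w : EuclideanSpace ℝ (Fin 3) → EuclideanSpace ℝ (Fin 3)) (c : EuclideanSpace ℝ (Fin 3)) (M : ℝ) (μ : Measure E3),
      let G : E3 → E3 := (fun x => (Jst w • (curl (curl (fun y => fderiv ℝ w y (curl w y))) x -
          curl (fun y => fderiv ℝ (curl w) y (curl w y)) x +
          curl (curl (fun y => ∑ j, ⟪curl w y, fderiv ℝ w y (EuclideanSpace.basisFun (Fin 3) ℝ j)⟫_ℝ •
          EuclideanSpace.basisFun (Fin 3) ℝ j)) x) +
        (-(kStar ^ 2 * M ^ 2 * Wpa w)) • curl (curl (curl w)) x -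
        (-(kStar ^ 2 * M ^ 2 * Zen w)) • curl (curl (Δ (curl w))) x))
      (AnalyticOnNhd ℝ w Set.univ ∧ ContDiff ℝ (⊤ : ℕ∞) w ∧ Literature.Analysis.FluidPDE.VectorCalculus.IsDivFree w ∧ (∃ B : ℝ, ∀ x, ‖fderiv ℝ w x‖ ≤ B) ∧ (∫⁻ x, ‖iteratedFDeriv ℝ 1 w x‖ₑ ^ 2 < ⊤) ∧ (∫⁻ x, ‖iteratedFDeriv ℝ 2 w x‖ₑ ^ 2 < ⊤) ∧ 0 < M ∧ (∀ x, ‖w x‖ = M) ∧ ‖c‖ = M ∧ Filter.Tendsto (fun x => w x - c) (Filter.cocompact (EuclideanSpace ℝ (Fin 3))) (nhds 0) ∧ MeasureTheory.MemLp (fun x => w x - c) 6 MeasureTheory.volume ∧ (∀ x, ⟪w x - c, c⟫_ℝ = -(‖w x - c‖ ^ 2 / 2)) ∧ (∃ x, ⟪w x, c⟫_ℝ ≤ 0) ∧ ¬ Filter.Tendsto (fun R : ℝ => R⁻¹ * ∫ x in {x : EuclideanSpace ℝ (Fin 3) | R ≤ ‖x‖ ∧ ‖x‖ ≤ 2 *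 R}, ‖w x - c‖) Filter.atTop (nhds 0) ∧ 0 < M * Real.sqrt (∫ x, ‖Literature.Analysis.FluidPDE.curl w x‖ ^ 2) * Real.sqrt (∫ x, Literature.Analysis.FluidPDE.frobeniusNormSq (fderiv ℝ (Literature.Analysis.FluidPDE.curl w) x)) ∧ (sInf {κ : ℝ | (∀ (v : EuclideanSpace ℝ (Fin 3) → EuclideanSpace ℝ (Fin 3)) (M B : ℝ), ContDiff ℝ (⊤ : ℕ∞) v → Literature.Analysis.FluidPDE.VectorCalculus.IsDivFree v → (∀ x, ‖v x‖ ≤ M) → (∀ x, ‖fderiv ℝ v x‖ ≤ B) → (∫⁻ x, ‖iteratedFDeriv ℝ 0 v x‖ₑ ^ 2 < ⊤) → (∫⁻ x, ‖iteratedFDeriv ℝ 1 v x‖ₑ ^ 2 < ⊤) → (∫⁻ x, ‖iteratedFDeriv ℝ 2 v x‖ₑ ^ 2 < ⊤) → |∫ x, ⟪Literature.Analysis.FluidPDE.curl v x, fderiv ℝ v x (Literature.Analysis.FluidPDE.curl v x)⟫_ℝ| ≤ κ * M * Real.sqrt (∫ x, ‖Literature.Analysis.FluidPDE.curl v x‖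 ^ 2) * Real.sqrt (∫ x, Literature.Analysis.FluidPDE.frobeniusNormSq (fderiv ℝ (Literature.Analysis.FluidPDE.curl v) x)))}) * M * Real.sqrt (∫ x, ‖Literature.Analysis.FluidPDE.curl w x‖ ^ 2) * Real.sqrt (∫ x, Literature.Analysis.FluidPDE.frobeniusNormSq (fderiv ℝ (Literature.Analysis.FluidPDE.curl w) x)) = |∫ x, ⟪Literature.Analysis.FluidPDE.curl w x, fderiv ℝ w x (Literature.Analysis.FluidPDE.curl w x)⟫_ℝ| ∧ (∀ (φ : EuclideanSpace ℝ (Fin 3) → EuclideanSpace ℝ (Fin 3)) (s : ℝ), ContDiff ℝ (⊤ : ℕ∞) φ → HasCompactSupport φ → Literature.Analysis.FluidPDE.VectorCalculus.IsDivFree φ → (∀ x, ⟪w x, φ x⟫_ℝ ≤ s) → (∫ x, ⟪Literature.Analysis.FluidPDE.curl w x, fderiv ℝ w x (Literature.Analysis.FluidPDE.curl w x)⟫_ℝ) * (∫ x, (⟪Literature.Analysis.FluidPDE.curl φ x, fderiv ℝ w x (Literature.Analysis.FluidPDE.curl w x)⟫_ℝ + ⟪Literature.Analysis.FluidPDE.curl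 w x, fderiv ℝ φ x (Literature.Analysis.FluidPDE.curl w x)⟫_ℝ + ⟪Literature.Analysis.FluidPDE.curl w x, fderiv ℝ w x (Literature.Analysis.FluidPDE.curl φ x)⟫_ℝ)) ≤ (sInf {κ : ℝ | (∀ (v : EuclideanSpace ℝ (Fin 3) → EuclideanSpace ℝ (Fin 3)) (M B : ℝ), ContDiff ℝ (⊤ : ℕ∞) v → Literature.Analysis.FluidPDE.VectorCalculus.IsDivFree v → (∀ x, ‖v x‖ ≤ M) → (∀ x, ‖fderiv ℝ v x‖ ≤ B) → (∫⁻ x, ‖iteratedFDeriv ℝ 0 v x‖ₑ ^ 2 < ⊤) → (∫⁻ x, ‖iteratedFDeriv ℝ 1 v x‖ₑ ^ 2 < ⊤) → (∫⁻ x, ‖iteratedFDeriv ℝ 2 v x‖ₑ ^ 2 < ⊤) → |∫ x, ⟪Literature.Analysis.FluidPDE.curl v x, fderiv ℝ v x (Literature.Analysis.FluidPDE.curl v x)⟫_ℝ| ≤ κ * M * Real.sqrt (∫ x, ‖Literature.Analysis.FluidPDE.curl v x‖ ^ 2) * Real.sqrt (∫ x, Literature.Analysis.FluidPDE.frobeniusNormSq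 (fderiv ℝ (Literature.Analysis.FluidPDE.curl v) x)))}) ^ 2 * M ^ 2 * (s / M ^ 2 * (∫ x, ‖Literature.Analysis.FluidPDE.curl w x‖ ^ 2) * (∫ x, Literature.Analysis.FluidPDE.frobeniusNormSq (fderiv ℝ (Literature.Analysis.FluidPDE.curl w) x)) + (∫ x, Literature.Analysis.FluidPDE.frobeniusNormSq (fderiv ℝ (Literature.Analysis.FluidPDE.curl w) x)) * (∫ x, ⟪Literature.Analysis.FluidPDE.curl w x, Literature.Analysis.FluidPDE.curl φ x⟫_ℝ) + (∫ x, ‖Literature.Analysis.FluidPDE.curl w x‖ ^ 2) * (∫ x, ∑ i, ⟪fderiv ℝ (Literature.Analysis.FluidPDE.curl w) x (EuclideanSpace.basisFun (Fin 3) ℝ i), fderiv ℝ (Literature.Analysis.FluidPDE.curl φ) x (EuclideanSpace.basisFun (Fin 3) ℝ i)⟫_ℝ)))) ∧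
      IsFiniteMeasure μ ∧ μ Set.univ ≤ ENNReal.ofReal (kStar ^ 2 * Zen w * Wpa w) ∧ Jst w ^ 2 ≤ 2 * M ^ 2 * μ.real Set.univ ∧
      (∀ φ : E3 → E3, ContDiff ℝ ∞ φ → HasCompactSupport φ → VectorCalculus.IsDivFree φ →
        Jst w * J1 w φ - kStar ^ 2 * M ^ 2 * (Wpa w * A1 w φ + Zen w * C1 w φ) = ∫ x, ⟪w x, φ x⟫_ℝ ∂μ) ∧
      ∫ x, ‖w x - c‖ ^ 2 ∂μ = 2 * Jst w ^ 2 ∧ ∫ x, ⟪w x, c⟫_ℝ ∂μ ≤ 0 ∧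
      (∀ ψ : E3 → ℝ, ContDiff ℝ ∞ ψ → HasCompactSupport ψ →
        ∫ x, ψ x * ⟪G x, w x⟫_ℝ = ∫ x, ψ x * ⟪w x, curl w x⟫_ℝ ∂μ) ∧
      (∀ x, 0 ≤ ⟪w x, curl w x⟫_ℝ * ⟪G x, w x⟫_ℝ) ∧
      (∀ x, ⟪w x, curl w x⟫_ℝ ≠ 0 → G x = curl (fun y => (⟪G y, w y⟫_ℝ / ⟪w y, curl w y⟫_ℝ) • w y) x) ∧
      IntegrableOn (fun x => ⟪G x, w x⟫_ℝ / ⟪w x, curl w x⟫_ℝ) {x | ⟪w x, curl w x⟫_ℝ ≠ 0} ∧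
      ∫ x in {x | ⟪w x, curl w x⟫_ℝ ≠ 0}, ⟪G x, w x⟫_ℝ / ⟪w x, curl w x⟫_ℝ ≤ kStar ^ 2 * Zen w * Wpa w ∧
      (∀ A : E3 →L[ℝ] E3, curlCLM A = 0 →
        Tendsto (fun R : ℝ => ∫ x, ⟪G x, cutoff R x • A x⟫_ℝ) atTop (𝓝 0)) ∧
      Tendsto (fun R : ℝ => ∫ x, ⟪G x, cutoff R x • cross c x⟫_ℝ) atTop (𝓝 (2 * ∫ x, ⟪w x, c⟫_ℝ ∂μ)) ∧
      (∀ Ψ₀ : E3 → E3, ContDiff ℝ ∞ Ψ₀ → HasCompactSupport Ψ₀ → tsupport Ψ₀ ⊆ {x | ⟪w x, curl w x⟫_ℝ ≠ 0} →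
        ∀ P : ℝ, (∀ x, ‖(curl fun y => Ψ₀ y - (⟪w y, curl Ψ₀ y⟫_ℝ / ⟪w y, curl w y⟫_ℝ) • w y) x‖ ^ 2 ≤ P) →
        (∀ x, ⟪w x, (curl fun y => Ψ₀ y - (⟪w y, curl Ψ₀ y⟫_ℝ / ⟪w y, curl w y⟫_ℝ) • w y) x⟫_ℝ = 0) ∧
        J1 w (curl fun y => Ψ₀ y - (⟪w y, curl Ψ₀ y⟫_ℝ / ⟪w y, curl w y⟫_ℝ) • w y) ^ 2 +
          2 * Jst w * (∫ x, (⟪curl (curl fun y => Ψ₀ y - (⟪w y, curl Ψ₀ y⟫_ℝ / ⟪w y, curl w y⟫_ℝ) • w y) x, fderiv ℝ (curl fun y => Ψ₀ y - (⟪w y, curl Ψ₀ y⟫_ℝ / ⟪w y, curl w y⟫_ℝ) • w y) x (curl w x)⟫_ℝ +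
            ⟪curl (curl fun y => Ψ₀ y - (⟪w y, curl Ψ₀ y⟫_ℝ / ⟪w y, curl w y⟫_ℝ) • w y) x, fderiv ℝ w x (curl (curl fun y => Ψ₀ y - (⟪w y, curl Ψ₀ y⟫_ℝ / ⟪w y, curl w y⟫_ℝ) • w y) x)⟫_ℝ +
            ⟪curl w x, fderiv ℝ (curl fun y => Ψ₀ y - (⟪w y, curl Ψ₀ y⟫_ℝ / ⟪w y, curl w y⟫_ℝ) • w y) x (curl (curl fun y => Ψ₀ y - (⟪w y, curl Ψ₀ y⟫_ℝ / ⟪w y, curl w y⟫_ℝ) • w y) x)⟫_ℝ)) ≤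
          kStar ^ 2 * (P * Zen w * Wpa w + M ^ 2 * ((∫ x, ‖curl (curl fun y => Ψ₀ y - (⟪w y, curl Ψ₀ y⟫_ℝ / ⟪w y, curl w y⟫_ℝ) • w y) x‖ ^ 2) * Wpa w +
            4 * A1 w (curl fun y => Ψ₀ y - (⟪w y, curl Ψ₀ y⟫_ℝ / ⟪w y, curl w y⟫_ℝ) • w y) * C1 w (curl fun y => Ψ₀ y - (⟪w y, curl Ψ₀ y⟫_ℝ / ⟪w y, curl w y⟫_ℝ) • w y) + (∫ x, frobeniusNormSq (fderiv ℝ (curl (curl fun y => Ψ₀ y - (⟪w y, curl Ψ₀ y⟫_ℝ / ⟪w y, curl w y⟫_ℝ) • w y)) x)) * Zen w)))) :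
    ¬ ∃ (w : EuclideanSpace ℝ (Fin 3) → EuclideanSpace ℝ (Fin 3)), AnalyticOnNhd ℝ w Set.univ ∧ (ContDiff ℝ (⊤ : ℕ∞) w ∧ Literature.Analysis.FluidPDE.VectorCalculus.IsDivFree w ∧ (∃ B : ℝ, ∀ x, ‖fderiv ℝ w x‖ ≤ B) ∧ (∫⁻ x, ‖iteratedFDeriv ℝ 1 w x‖ₑ ^ 2 < ⊤) ∧ (∫⁻ x, ‖iteratedFDeriv ℝ 2 w x‖ₑ ^ 2 < ⊤) ∧ ∃ M : ℝ, (∀ x, ‖w x‖ ≤ M) ∧ 0 < M * Real.sqrt (∫ x, ‖Literature.Analysis.FluidPDE.curl w x‖ ^ 2) * Real.sqrt (∫ x, Literature.Analysis.FluidPDE.frobeniusNormSq (fderiv ℝ (Literature.Analysis.FluidPDE.curl w) x)) ∧ (sInf {κ : ℝ | (∀ (v : EuclideanSpace ℝ (Fin 3) → EuclideanSpace ℝ (Fin 3)) (M B : ℝ), ContDiff ℝ (⊤ : ℕ∞) v → Literature.Analysis.FluidPDE.VectorCalculus.IsDivFree v → (∀ x, ‖v x‖ ≤ M) → (∀ x,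 ‖fderiv ℝ v x‖ ≤ B) → (∫⁻ x, ‖iteratedFDeriv ℝ 0 v x‖ₑ ^ 2 < ⊤) → (∫⁻ x, ‖iteratedFDeriv ℝ 1 v x‖ₑ ^ 2 < ⊤) → (∫⁻ x, ‖iteratedFDeriv ℝ 2 v x‖ₑ ^ 2 < ⊤) → |∫ x, ⟪Literature.Analysis.FluidPDE.curl v x, fderiv ℝ v x (Literature.Analysis.FluidPDE.curl v x)⟫_ℝ| ≤ κ * M * Real.sqrt (∫ x, ‖Literature.Analysis.FluidPDE.curl v x‖ ^ 2) * Real.sqrt (∫ x, Literature.Analysis.FluidPDE.frobeniusNormSq (fderiv ℝ (Literature.Analysis.FluidPDE.curl v) x)))}) * M * Real.sqrt (∫ x, ‖Literature.Analysis.FluidPDE.curl w x‖ ^ 2) * Real.sqrt (∫ x, Literature.Analysis.FluidPDE.frobeniusNormSq (fderiv ℝ (Literature.Analysis.FluidPDE.curl w) x)) ≤ |∫ x, ⟪Literature.Analysis.FluidPDE.curl w x, fderiv ℝ w x (Literature.Analysis.FluidPDE.curl w x)⟫_ℝ|) := by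
  refine stub_noAnalyticExtremal_of_noDossierObject ?_
  rintro ⟨w, c, M, han, hcd, hdiv, ⟨B, hB⟩, h1, h2, hMpos, hM, hcM, hdec, hmem, hid, hrev, hslow, hpos, heq, hKKT⟩
  have hatt : |Jst w| = kStar * M * Real.sqrt (Zen w) * Real.sqrt (Wpa w) := heq.symm
  have hZ0 : 0 ≤ Zen w := integral_nonneg fun x => sq_nonneg _
  have hW0 : 0 ≤ Wpa w := integral_nonneg fun x => frobeniusNormSq_nonneg _
  obtain ⟨μ, hfin, hmass, hμ⟩ := exists_multiplierMeasure hcd hdiv hMpos hM hB h1 h2 hatt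
  haveI := hfin
  set G : E3 → E3 := fun x => (Jst w • (curl (curl (fun y => fderiv ℝ w y (curl w y))) x -
          curl (fun y => fderiv ℝ (curl w) y (curl w y)) x +
          curl (curl (fun y => ∑ j, ⟪curl w y, fderiv ℝ w y (EuclideanSpace.basisFun (Fin 3) ℝ j)⟫_ℝ •
          EuclideanSpace.basisFun (Fin 3) ℝ j)) x) +
        (-(kStar ^ 2 * M ^ 2 * Wpa w)) • curl (curl (curl w)) x -
        (-(kStar ^ 2 * M ^ 2 * Zen w)) • curl (curl (Δ (curl w))) x) with hGdef
  have hGs : ContDiff ℝ ∞ G := contDiff_density hcd _ _ _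
  have hG : ∀ η : E3 → E3, ContDiff ℝ ∞ η → HasCompactSupport η →
      Jst w * J1 w (curl η) - kStar ^ 2 * M ^ 2 * (Wpa w * A1 w (curl η) + Zen w * C1 w (curl η)) =
        ∫ x, ⟪G x, η x⟫_ℝ := by
    intro η hη hηc
    rw [hGdef, ← density_formula hcd (Jst w) (-(kStar ^ 2 * M ^ 2 * Wpa w)) (-(kStar ^ 2 * M ^ 2 * Zen w)) hη hηc]
    show Jst w * J1 w (curl η) - kStar ^ 2 * M ^ 2 * (Wpa w * A1 w (curl η) + Zen w * C1 w (curl η)) =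
      Jst w * J1 w (curl η) + -(kStar ^ 2 * M ^ 2 * Wpa w) * A1 w (curl η) + -(kStar ^ 2 * M ^ 2 * Zen w) * C1 w (curl η)
    ring
  have hMle : ∀ x, ‖w x‖ ≤ M := fun x => (hM x).le
  obtain ⟨hint, hintle⟩ := integrableOn_density_twistSet hcd hGs.continuous hG hμ
  refine hres ⟨w, c, M, μ, ?_⟩
  intro G'
  have hGG : G' = G := rfl
  rw [hGG]
  refine ⟨⟨han, hcd, hdiv, ⟨B, hB⟩, h1, h2, hMpos, hM, hcM, hdec, hmem, hid, hrev, hslow, hpos, heq, hKKT⟩, hfin, hmass,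
    multiplier_mass_ge hcd hdiv hM hB h1 h2 hatt hcM hmem hμ, hμ,
    multiplier_integral_normSq_sub hcd hdiv hM hB h1 h2 hatt hcM hmem hμ,
    (multiplier_integral_inner_farField_nonpos hcd hdiv hM hB h1 h2 hatt hmem hmass hμ).2,
    fun ψ hψ hψc => multiplier_helicity_identity hcd hG hμ hψ hψc,
    fun x => helicity_mul_inner_density_nonneg hcd hGs.continuous hG hμ x,
    fun x hx => strongEulerLagrange_on_twist_ne_zero hcd hGs hG hμ hx, hint, ?_,
    fun A hA => tendsto_integral_density_cutoff_clm_of_curl_eq_zero hcd hMle hG hμ hA,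
    tendsto_integral_density_cutoff_cross hcd hMle hG hμ c, fun Ψ₀ hΨ hΨc hΨU P hP => ?_⟩
  · refine hintle.trans ?_
    rw [measureReal_def]
    exact ENNReal.toReal_le_of_le_ofReal (by positivity) hmass
  · obtain ⟨hφ, hφc, hφdiv, htan⟩ := tangentialTestField_props hcd hΨ hΨc hΨU
    exact ⟨htan, ext_secondVariation_le_of_inward hcd hdiv hM hB h1 h2 hatt hφ hφc hφdiv (fun x => (htan x).le) hP
      (firstVariation_tangentialTestField_eq_zero hcd hμ hΨ hΨc hΨU)⟩

end ExtremiserLiouville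

end Summit.NavierStokesRegularity.NavierStokesRegularity.Theorems

end
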